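import Summits.QuantumFields.GaugeBoot.OneOverNMaster
import Summits.QuantumFields.GaugeBoot.OneOverNFirstOrderFactorizationMain
import HarnessLib

/-!
# Fluctuations of Wilson loops in the 't Hooft limit, I: the limiting covariance (gauge-boot, ADDENDUM 32 part A)

HONEST FRAMING (cell `pub-gaugeboot`, page 1 of every file): the venture produces certified bounds
on lattice expectations at stated coupling, gauge group, dimension and torus size; NOT a mass gap,
NOT a continuum limit, NOT a string tension; NOT Yang–Mills-summit-bearing (barriers
`FixedCouplingUltralocality`, `PerturbativeInvisibility`).  Strong-coupling `SO(N)` lattice gauge theory with free boundary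
condition (S. Chatterjee, Comm. Math. Phys. **366** (2019); S. Chatterjee, J. Jafarov, arXiv:1604.04777); nothing about
four-dimensional continuum Yang–Mills or a mass gap.

## Content

The first statement of the lane's programme on FLUCTUATIONS of Wilson loop variables at large `N` (a consequence of the `1/N`
expansion to second order and the first-order factorization, not stated in the sources): for `|β| ≤ β_c(d)` and every pair of
loops `l, l'` the covariance of the (unnormalised!) Wilson loop variables has a finite large-`N` limit,

`Cov_{Λ_N,N,β}(W_l, W_{l'}) = N²(φ_N(l,l') − φ_N(l)φ_N(l')) → κ_β(l,l') := f_2(l,l') − f_2(l)f_0(l') − f_1(l)f_1(l') − f_0(l)f_2(l')`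

along every admissible sequence of cubes (`covariance_limit`) — i.e. Wilson loop variables have `O(1)` fluctuations in the 't Hooft
limit at strong coupling.  Tool: `expansion_coeff_unique` (two families with the expansion property agree — limits are unique), used to
import the first-order factorization of `firstOrder_factorization` for the master family.

`[new (lane)]` as a statement; everything is `[folklore]` given `oneOverN_master` and `firstOrder_factorization`.
-/

noncomputable section

open Finset Filter Topology
open Literature.Probability.LatticeModels (Site box)
open Literature.MathematicalPhysics.QuantumFieldTheory.Chatterjee2019LargeN

namespace Summit.QuantumFields.GaugeBoot

namespace StringDuality

variable {d : ℕ}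

/-- **The coefficients of the `1/N` expansion are unique**: two families with the expansion property up to order `K` (along the
cubes `[−N,N]^d`, at a fixed `β`) agree up to order `K` on genuine loop sequences. [folklore] -/
theorem expansion_coeff_unique {β : ℝ} {K : ℕ} {F F' : ℕ → ℝ → LoopSeq d → ℝ}
    (hF : ∀ k, k ≤ K → ∀ s : LoopSeq d, IsLoopSeq s →
      Tendsto (fun N : ℕ => (N : ℝ) ^ k *
        (phi N β (box d N) s - ∑ i ∈ Finset.range k, F (i + 2) β s / (N : ℝ) ^ i)) atTop (𝓝 (F (k + 2) β s)))
    (hF' : ∀ k, k ≤ K → ∀ s : LoopSeq d, IsLoopSeq s →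
      Tendsto (fun N : ℕ => (N : ℝ) ^ k *
        (phi N β (box d N) s - ∑ i ∈ Finset.range k, F' (i + 2) β s / (N : ℝ) ^ i)) atTop (𝓝 (F' (k + 2) β s))) :
    ∀ k, k ≤ K → ∀ s : LoopSeq d, IsLoopSeq s → F (k + 2) β s = F' (k + 2) β s := by
  intro k
  induction k using Nat.strong_induction_on with
  | _ k ih =>
  intro hk s hs
  have heq : (fun N : ℕ => (N : ℝ) ^ k * (phi N β (box d N) s - ∑ i ∈ Finset.range k, F (i + 2) β s / (N : ℝ) ^ i)) =
      fun N : ℕ => (N : ℝ) ^ k * (phi N β (box d N) s - ∑ i ∈ Finset.range k, F' (i + 2) β s / (N : ℝ) ^ i) := by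
    funext N
    congr 2
    exact Finset.sum_congr rfl fun i hi => by rw [ih i (Finset.mem_range.mp hi) (by have := Finset.mem_range.mp hi; omega) s hs]
  have h1 := hF k hk s hs
  rw [heq] at h1
  exact tendsto_nhds_unique h1 (hF' k hk s hs)

/-- Second-order asymptotics of a product: if `N²(x_N − a₀ − a₁/N) → a₂` and `N²(y_N − b₀ − b₁/N) → b₂` then
`N²(x_N y_N − a₀b₀ − (a₁b₀ + a₀b₁)/N) → a₂b₀ + a₁b₁ + a₀b₂`. [folklore] -/
theorem tendsto_sq_mul_prod {x y : ℕ → ℝ} {a₀ a₁ a₂ b₀ b₁ b₂ : ℝ}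
    (hx : Tendsto (fun N : ℕ => (N : ℝ) ^ 2 * (x N - a₀ - a₁ / N)) atTop (𝓝 a₂))
    (hy : Tendsto (fun N : ℕ => (N : ℝ) ^ 2 * (y N - b₀ - b₁ / N)) atTop (𝓝 b₂)) :
    Tendsto (fun N : ℕ => (N : ℝ) ^ 2 * (x N * y N - a₀ * b₀ - (a₁ * b₀ + a₀ * b₁) / N)) atTop
      (𝓝 (a₂ * b₀ + a₁ * b₁ + a₀ * b₂)) := by
  -- remainders `r_N = N²(x_N − a₀ − a₁/N)`, `q_N = N²(y_N − b₀ − b₁/N)`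
  have hinv : Tendsto (fun N : ℕ => (1 : ℝ) / N) atTop (𝓝 0) := tendsto_one_div_atTop_nhds_zero_nat
  have hinv2 : Tendsto (fun N : ℕ => ((1 : ℝ) / N) ^ 2) atTop (𝓝 0) := by simpa using hinv.pow 2
  have hlim : Tendsto (fun N : ℕ =>
      ((N : ℝ) ^ 2 * (x N - a₀ - a₁ / N)) * b₀ + a₁ * b₁ + a₀ * ((N : ℝ) ^ 2 * (y N - b₀ - b₁ / N))
        + ((1 : ℝ) / N) * (a₁ * ((N : ℝ) ^ 2 * (y N - b₀ - b₁ / N)) + ((N : ℝ) ^ 2 * (x N - a₀ - a₁ / N)) * b₁)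
        + ((1 : ℝ) / N) ^ 2 * (((N : ℝ) ^ 2 * (x N - a₀ - a₁ / N)) * ((N : ℝ) ^ 2 * (y N - b₀ - b₁ / N))))
      atTop (𝓝 (a₂ * b₀ + a₁ * b₁ + a₀ * b₂ + 0 * (a₁ * b₂ + a₂ * b₁) + 0 * (a₂ * b₂))) :=
    ((((hx.mul_const b₀).add tendsto_const_nhds).add (hy.const_mul a₀)).add
      (hinv.mul ((hy.const_mul a₁).add (hx.mul_const b₁)))).add (hinv2.mul (hx.mul hy))
  simp only [zero_mul, add_zero] at hlim
  refine (hlim.congr' ?_)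
  filter_upwards [eventually_gt_atTop 0] with N hN
  have hN : (N : ℝ) ≠ 0 := by exact_mod_cast hN.ne'
  field_simp
  ring

variable (d)

/-- ★ **The limiting covariance of Wilson loop variables in the 't Hooft limit at strong coupling.**  For `d ≥ 2` there is
`β_c > 0` and, with `F` the family of the `1/N` expansion (clause (i): the expansion along the cubes `[−N,N]^d` up to second order,
which pins `F_2, F_3, F_4`), for every `|β| ≤ β_c`, every admissible sequence of cubes `Λ_N = [−M_N, M_N]^d` (`a log₂N ≤ M_N`
eventually, every `a`) and every genuine pair of loops `(l, l')`:
`N²(φ_{Λ_N,N,β}(l,l') − φ_{Λ_N,N,β}(l) φ_{Λ_N,N,β}(l')) → κ_β(l,l') := F_4(β,(l,l')) − F_4(β,(l))F_2(β,(l')) − F_3(β,(l))F_3(β,(l')) − F_2(β,(l))F_4(β,(l'))`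
— and `N²φ_N(l,l') = ⟨W_l W_{l'}⟩`, `Nφ_N(l) = ⟨W_l⟩`, so this is **`Cov_{Λ_N,N,β}(W_l, W_{l'}) → κ_β(l,l')`** (clause (iii)): the
unnormalised Wilson loop variables have bounded fluctuations.  Ingredients: the expansion to second order and
`f_0(l,l') = f_0(l)f_0(l')`, `f_1(l,l') = f_1(l)f_0(l') + f_0(l)f_1(l')`.
[cite: ChatterjeeJafarov2016OneOverN, Theorem 3.1 (ii); Chatterjee2019LargeN, Corollary 3.2] -/
theorem covariance_limit (hd : 2 ≤ d) :
    ∃ βc : ℝ, 0 < βc ∧ ∃ F : ℕ → ℝ → LoopSeq d → ℝ,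
      (∀ k, k ≤ 2 → ∀ β : ℝ, |β| ≤ βc → ∀ s : LoopSeq d, IsLoopSeq s →
        Tendsto (fun N : ℕ => (N : ℝ) ^ k *
          (phi N β (box d N) s - ∑ i ∈ Finset.range k, F (i + 2) β s / (N : ℝ) ^ i)) atTop (𝓝 (F (k + 2) β s))) ∧
      (∀ β : ℝ, |β| ≤ βc → ∀ M : ℕ → ℕ, (∀ a : ℕ, ∀ᶠ N : ℕ in atTop, a * Nat.log 2 N ≤ M N) →
        ∀ l l' : List (DEdge d), IsLoopSeq [l, l'] →
          Tendsto (fun N : ℕ => (N : ℝ) ^ 2 *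
            (phi N β (box d (M N)) [l, l'] - phi N β (box d (M N)) [l] * phi N β (box d (M N)) [l'])) atTop
            (𝓝 (F 4 β [l, l'] - F 4 β [l] * F 2 β [l'] - F 3 β [l] * F 3 β [l'] - F 2 β [l] * F 4 β [l']))) ∧
      (∀ β : ℝ, |β| ≤ βc → ∀ M : ℕ → ℕ, (∀ a : ℕ, ∀ᶠ N : ℕ in atTop, a * Nat.log 2 N ≤ M N) →
        ∀ l l' : List (DEdge d), IsLoopSeq [l, l'] →
          Tendsto (fun N : ℕ =>
            soExpect N β (box d (M N)) (fun U => wilsonLoopVar N l U * wilsonLoopVar N l' U)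
              - soExpect N β (box d (M N)) (wilsonLoopVar N l) * soExpect N β (box d (M N)) (wilsonLoopVar N l')) atTop
            (𝓝 (F 4 β [l, l'] - F 4 β [l] * F 2 β [l'] - F 3 β [l] * F 3 β [l'] - F 2 β [l] * F 4 β [l']))) := by
  obtain ⟨β₀, hpos, hanti, C, L, hC, hL, F, hF0, hF1, HA, HB, -⟩ := oneOverN_master d hd
  obtain ⟨β₁, hβ₁, F', hF'exp, -, hF'fact⟩ := firstOrder_factorization d hd
  -- the main clause, in `φ` form
  have main : ∀ β : ℝ, |β| ≤ min (β₀ 2) β₁ → ∀ M : ℕ → ℕ, (∀ a : ℕ, ∀ᶠ N : ℕ in atTop, a * Nat.log 2 N ≤ M N) →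
      ∀ l l' : List (DEdge d), IsLoopSeq [l, l'] →
        Tendsto (fun N : ℕ => (N : ℝ) ^ 2 *
          (phi N β (box d (M N)) [l, l'] - phi N β (box d (M N)) [l] * phi N β (box d (M N)) [l'])) atTop
          (𝓝 (F 4 β [l, l'] - F 4 β [l] * F 2 β [l'] - F 3 β [l] * F 3 β [l'] - F 2 β [l] * F 4 β [l'])) := by
    intro β hβ M hM l l' hll
    have hb2 : |β| ≤ β₀ 2 := hβ.trans (min_le_left _ _)
    have hb1 : |β| ≤ β₀ 1 := hb2.trans (hanti 1)
    have hb0 : |β| ≤ β₀ 0 := hb1.trans (hanti 0)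
    have hbF : |β| ≤ β₁ := hβ.trans (min_le_right _ _)
    have hl : IsLoopSeq [l] := fun w hw => hll w (by simp at hw; simp [hw])
    have hl' : IsLoopSeq [l'] := fun w hw => hll w (by simp at hw; simp [hw])
    -- the master family agrees with the family of `firstOrder_factorization` at orders 0, 1
    have hagree : ∀ k, k ≤ 1 → ∀ s : LoopSeq d, IsLoopSeq s → F (k + 2) β s = F' (k + 2) β s :=
      expansion_coeff_unique (fun k hk s hs => (HA k β (by interval_cases k <;> assumption)).2.2.2.2.1 s hs)
        (fun k hk s hs => hF'exp k hk β hbF s hs)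
    have h00 : F 2 β [l, l'] = F 2 β [l] * F 2 β [l'] := by
      rw [hagree 0 (by norm_num) _ hll, hagree 0 (by norm_num) _ hl, hagree 0 (by norm_num) _ hl', (hF'fact β hbF).1 _ hll]
      simp
    have h11 : F 3 β [l, l'] = F 3 β [l] * F 2 β [l'] + F 2 β [l] * F 3 β [l'] := by
      rw [hagree 1 le_rfl _ hll, hagree 1 le_rfl _ hl, hagree 0 (by norm_num) _ hl', hagree 0 (by norm_num) _ hl,
        hagree 1 le_rfl _ hl']
      exact (hF'fact β hbF).2.2 l l' hll
    -- the three expansions to second order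
    have e2 := fun (s : LoopSeq d) (hs : IsLoopSeq s) => (HA 2 β hb2).2.2.2.1 M hM s hs
    have hx := e2 [l] hl
    have hy := e2 [l'] hl'
    have hz := e2 [l, l'] hll
    simp only [Finset.sum_range_succ, Finset.sum_range_zero, zero_add, pow_zero, div_one, pow_one] at hx hy hz
    have hx' : Tendsto (fun N : ℕ => (N : ℝ) ^ 2 * (phi N β (box d (M N)) [l] - F 2 β [l] - F 3 β [l] / N)) atTop
        (𝓝 (F 4 β [l])) := hx.congr fun N => by ring
    have hy' : Tendsto (fun N : ℕ => (N : ℝ) ^ 2 * (phi N β (box d (M N)) [l'] - F 2 β [l'] - F 3 β [l'] / N)) atTop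
        (𝓝 (F 4 β [l'])) := hy.congr fun N => by ring
    have hprod := tendsto_sq_mul_prod hx' hy'
    have hdiff := hz.sub hprod
    rw [show F 4 β [l, l'] - F 4 β [l] * F 2 β [l'] - F 3 β [l] * F 3 β [l'] - F 2 β [l] * F 4 β [l'] =
      F (2 + 2) β [l, l'] - (F 4 β [l] * F 2 β [l'] + F 3 β [l] * F 3 β [l'] + F 2 β [l] * F 4 β [l']) by ring]
    refine hdiff.congr' ?_
    filter_upwards with N
    rw [h00, h11]
    ring
  refine ⟨min (β₀ 2) β₁, lt_min (hpos 2) hβ₁, F, fun k hk β hβ s hs => ?_, main, fun β hβ M hM l l' hll => ?_⟩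
  · have hb : |β| ≤ β₀ k := by
      interval_cases k
      · exact (hβ.trans (min_le_left _ _)).trans ((hanti 1).trans (hanti 0))
      · exact (hβ.trans (min_le_left _ _)).trans (hanti 1)
      · exact hβ.trans (min_le_left _ _)
    exact (HA k β hb).2.2.2.2.1 s hs
  refine (main β hβ M hM l l' hll).congr' ?_
  filter_upwards [eventually_gt_atTop 0] with N hN
  have hN : (N : ℝ) ≠ 0 := by exact_mod_cast hN.ne'
  have hw2 : wilsonProd N [l, l'] = fun U => wilsonLoopVar N l U * wilsonLoopVar N l' U := by
    funext U; simp [wilsonProd]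
  have hw1 : ∀ w : List (DEdge d), wilsonProd N [w] = wilsonLoopVar N w := by
    intro w; funext U; simp [wilsonProd]
  simp only [phi, hw2, hw1, List.length_cons, List.length_nil]
  field_simp
  ring

end StringDuality

end Summit.QuantumFields.GaugeBoot

end
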